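import Summits.QuantumFields.BalabanUV.Beta.GAN24.CombBornLambdaLineage
import Summits.QuantumFields.BalabanUV.Beta.GAN24.BornLambdaLift
import Summits.QuantumFields.BalabanUV.Beta.GAN24.E3UnitSplitLevelsSymAt

/-!
# The UNDRESSED Λ-lineage of the comb-chart remainder, born at level `i` and read at level `k`, is road S3's one-shot row-Λ object over the LIFTED table
# `avgLift M ∘ tabs.H` — and at an1's sym table it is the SYMMETRISED Lagrange increment `symLagrIncAt` (the (III′) twin of the OWNER's (Λ-U) `BornLambdaLift` §4–§5
# and of `BornLambdaTent` §3)

NOT IN PRINT — OUR BOOKKEEPING (road-P2 = `b2b-balaban-gan24-p2` gen 56, 2026-08-25; row G-an2-4 ∕ (CONV-C), the (α-0) chain at row D1's literal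
OF RECORD (III′) `JsB12CombShSym`; [folklore] composition BY NAME; 0 `def`, 0 cite, 0 `def … : Prop`, 0 `sorry`).  Weight 0.  NEVER «G-an2-4 closed» as (CONV-C);
NOT D1, NOT BetaPertH, NOT continuum, NOT Clay; NO campaign opened (an2 W-4) — a brick of the located `hUg-Λ` transfer (road-P2 MEMO M-gan24p2-g56-1).

Over M.58 `CombBornLambdaLineage` (`unitS_combFreshAt_lam_zero ∕ _succ`, `isFF_combFreshAt_lam`, `isLoc_unitS_combFreshAt_lam`), the OWNER gan24-p1 g21's `BornLambdaLift` §2–§3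
(`push₃_respStep_eq_e3OfS_borderSum`, `borderSum_SLam` — GENERIC in the table) and g20's `BornLambdaTent` (`lamCoeffK_KStepUnit_eq_neg_tent`, `SLam_const_mul`,
`contourSumAdj_const_mul` — coefficient-side, table-free) BY NAME, for ANY `tabs : SymTables d Lc` with ff-valued Hessian table (`hHff` displayed):
* §1 THE TENT SHAPE: `unitS_combFreshAt_lam_zero_eq_tent`, **`unitS_combFreshAt_lam_succ_eq_tent`** — the Λ-source of member `j+1` in units is ONE Λ-piece over `tabs.H` with the
  `j`-free weight `−cΛ` and the tent coefficient `𝒬ᵀ_{Lc}[(Lc^{j+1})^{2(d+1)}·wΦ_{Lc^{j+2}}(·; μ, · − y)]` (the (E) statements with `hessFFAt ρ ↦ tabs.H`).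
* §2 `exists_abs_tabsH_le` (the record's (LH) at rate `0`: `tabs.H` is entrywise bounded).
* §3 **`borderSum_unitS_combFreshAt_lam_succ (hHff) (cΛ j κ u)`**: `borderSum (Lc^(j+1)) (unitS_{j+1} (combFreshAt tabs 0 cΛ (j+1))) κ u
  = (cΛ·(Lc^(j+1))^{2(d+1)}) • SLam (Lc^(j+2)) (lamCoeffOf (KInv (Lc^(j+2))) (Lc^(j+2))) (avgLift (Lc^(j+1)) ∘ tabs.H) κ u` — the lift of the comb Λ-source is the Λ-increment of
  the LIFTED table (the (E) proof token for token: `contourSumAdj_mul`, `lamCoeffOf_KInv_eq_neg_contourSumAdj_shift`).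
* §4 THE LINEAGES (generic `tabs`): **`lineage_succ_eq_e3OfS`** (`push₃ B³ (unitS_{j+1} (combFreshAt tabs 0 cΛ (j+1))) = e3OfS (Lc^(j+n+2)) ((((Lc^(j+1))^{d+2})²·cΛ·(Lc^(j+1))^{2(d+1)}) •
  SLam … (avgLift (Lc^(j+1)) ∘ tabs.H))`, `B = respStep (Lc^(j+1)) (Lc^(j+n+2))`), **`lineage_zero_eq_e3OfS`** (member `0`: `= e3OfS (Lc^k) (cΛ • SLam Lc (lamCoeffOf (KInv Lc) Lc) tabs.H)`).
* §5 AT an1's SYM TABLE (`hH : tabs.H = symHessFFAt ρ Lc` — the record's `H`): **`lineage_succ_eq_e3OfS_symLagrIncAt`**, **`lineage_zero_eq_e3OfS_sym`** — the undressed Λ-lineages of the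
  comb-chart remainder ARE road S3's row-Λ ∕ row-Λt ∕ row-Λ0 objects for `E3UnitSplitLevelsSymAt.symLagrIncAt d ρ Lc` (M.66) ∕ the sym `S₀` stencil, up to the displayed scalars — exactly
  the objects M.69 `TaylorRowLamSymAt.rowL_three_at` ∕ M.72 `TaylorRowLamTopSymAt.rowLamTop_at` ∕ M.74 `S3ShapeL0SymAt.rowL0_holds_at` price.
Discharges NO letter by itself (the assembly is the next brick, the twin of `BornLambdaUndressedRow`); NO estimate.
-/

noncomputable section

open Finset
open scoped BigOperators
open Literature.MathematicalPhysics.QuantumFieldTheory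
open Literature.MathematicalPhysics.QuantumFieldTheory.Balaban1983to89
open Literature.MathematicalPhysics.QuantumFieldTheory.Balaban1983to89.Beta
open B12Sec2to5 (l1 l1_nonneg)
open ExpKernelCalculus (MKer VertexFamily BiLoc)
open AffineAveraging (Site box toSite Form1)
open AffineReproduction (contourSumAdj)
open KernelSpecInstance (wΦ)
open OneStepResolventKernel (Fib LocStencil KInv)
open BalabanStepJets (lamCoeffOf)
open BalabanStepJetsSucc (E2 lamCoeffK)
open BalabanCompositeJets (respStep)
open InterLevelTransport (SLam avgLift)
open DecLiftAdjoint (borderSum)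
open Summit.QuantumFields.BalabanUV.Beta.HessKerDressedUnits (unitS)
open Summit.QuantumFields.BalabanUV.Beta.SymmetrisedStepJets (SymTables)
open Summit.QuantumFields.BalabanUV.Beta.SymAveragingHessianCounts (symHessFFAt)
open Summit.QuantumFields.BalabanUV.Beta.GAN24.CombesThomas (sfStep smStep KStepUnit)
open Summit.QuantumFields.BalabanUV.Beta.GAN24.Push4 (IsFF)
open Summit.QuantumFields.BalabanUV.Beta.GAN24.Push3 (push₃)
open Summit.QuantumFields.BalabanUV.Beta.GAN24.E3UnitSplit (e3OfS)
open Summit.QuantumFields.BalabanUV.Beta.GAN24.TaylorLamVertexPairing (contourSumAdj_mul)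
open Summit.QuantumFields.BalabanUV.Beta.GAN24.TaylorLamBracket (lamCoeffOf_KInv_eq_neg_contourSumAdj_shift)
open Summit.QuantumFields.BalabanUV.Beta.GAN24.BornLambdaTent (lamCoeffK_KStepUnit_eq_neg_tent SLam_const_mul contourSumAdj_const_mul)
open Summit.QuantumFields.BalabanUV.Beta.GAN24.BornLambdaLift (push₃_respStep_eq_e3OfS_borderSum borderSum_SLam abs_tentCoeff_le)
open Summit.QuantumFields.BalabanUV.Beta.GAN24.SrecWilsonSector (isFF_unitS isFF_smul)
open Summit.QuantumFields.BalabanUV.Beta.GAN24.WilsonSectorUndressedRow (e3OfS_eq_push₃)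
open Summit.QuantumFields.BalabanUV.Beta.GAN24.E3UnitSplitLevelsSymAt (symLagrIncAt)
open Summit.QuantumFields.BalabanUV.Beta.GAN24.CombBornSector (combFreshAt)
open Summit.QuantumFields.BalabanUV.Beta.GAN24.CombBornLambdaLineage (unitS_combFreshAt_lam_zero unitS_combFreshAt_lam_succ isFF_combFreshAt_lam isLoc_unitS_combFreshAt_lam
  isFF_SLam_of_isFF)

namespace Summit.QuantumFields.BalabanUV.Beta.GAN24.CombBornLambdaLift

variable {d : ℕ} {Lc : ℕ} [NeZero Lc] (tabs : SymTables d Lc) (hHff : ∀ μ y, IsFF (tabs.H μ y))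

/-! ## §1 The Λ-source of every member in units: one tent shape along the tower -/

/-- NOT IN PRINT; OUR BOOKKEEPING ([folklore]; the (III′) twin of the OWNER's `BornLambdaTent.unitS_freshAt_lam_zero_eq_tent`).  **MEMBER `0`**:
`unitS_0 (combFreshAt tabs 0 cΛ 0) = fun κ u ↦ (−cΛ) • SLam Lc (fun μ y κ′ u′ ↦ 𝒬ᵀ_{Lc}[wΦ_{Lc}(·; μ, · − y)](κ′, u′)) tabs.H κ u`. -/
theorem unitS_combFreshAt_lam_zero_eq_tent (cΛ : ℝ) :
    unitS (sfStep Lc 0) (smStep d Lc 0) (combFreshAt tabs 0 cΛ 0)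
      = fun κ u => (-cΛ) • SLam Lc (fun μ y κ' u' =>
          contourSumAdj Lc (fun κ'' q => wΦ (N := Lc) (d := d) κ'' μ (q - y)) κ' u') tabs.H κ u := by
  rw [unitS_combFreshAt_lam_zero]
  funext κ u
  have e0 : lamCoeffOf (KInv (N := Lc) (d := d)) Lc = fun μ y κ' u' => (-1 : ℝ) *
      contourSumAdj Lc (fun κ'' q => wΦ (N := Lc) (d := d) κ'' μ (q - y)) κ' u' := by
    funext μ y κ' u'
    rw [lamCoeffOf_KInv_eq_neg_contourSumAdj_shift (N := Lc) μ y κ' u', neg_one_mul]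
  rw [e0, SLam_const_mul, smul_smul, mul_neg_one]

include hHff in
/-- NOT IN PRINT; OUR BOOKKEEPING ([folklore]; the (III′) twin of `BornLambdaTent.unitS_freshAt_lam_succ_eq_tent`).  **MEMBERS `j+1`**:
`unitS_{j+1} (combFreshAt tabs 0 cΛ (j+1)) = fun κ u ↦ (−cΛ) • SLam Lc (fun μ y κ′ u′ ↦ 𝒬ᵀ_{Lc}[(Lc^{j+1})^{2(d+1)}·wΦ_{Lc^{j+2}}(·; μ, · − y)](κ′, u′)) tabs.H κ u` — M.58's
`unitS_combFreshAt_lam_succ` (weight `cΛ·Lc^{2(d+1)}`) and the OWNER's coefficient identity `lamCoeffK_KStepUnit_eq_neg_tent`: the two `Lc^{2(d+1)}` cancel, weight `−cΛ` `j`-FREE. -/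
theorem unitS_combFreshAt_lam_succ_eq_tent (cΛ : ℝ) (j : ℕ) :
    unitS (sfStep Lc (j + 1)) (smStep d Lc (j + 1)) (combFreshAt tabs 0 cΛ (j + 1))
      = fun κ u => (-cΛ) • SLam Lc (fun μ y κ' u' =>
          contourSumAdj Lc (fun κ'' y'' => ((Lc : ℝ) ^ (j + 1)) ^ (2 * (d + 1)) * wΦ (N := Lc ^ (j + 2)) (d := d) κ'' μ (y'' - y)) κ' u')
          tabs.H κ u := by
  rw [unitS_combFreshAt_lam_succ tabs hHff]
  funext κ u
  have hL : (Lc : ℝ) ^ (2 * (d + 1)) ≠ 0 := pow_ne_zero _ (Nat.cast_ne_zero.2 (NeZero.ne Lc))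
  have e : lamCoeffK (KStepUnit (d := d) Lc (j + 1)) ((smStep d Lc j) ^ 2 • E2 d Lc (j + 1)) Lc
      = fun μ y κ' u' => (-(((Lc : ℝ) ^ (2 * (d + 1)))⁻¹)) *
          contourSumAdj Lc (fun κ'' y'' => ((Lc : ℝ) ^ (j + 1)) ^ (2 * (d + 1)) * wΦ (N := Lc ^ (j + 2)) (d := d) κ'' μ (y'' - y)) κ' u' := by
    funext μ y κ' u'
    rw [lamCoeffK_KStepUnit_eq_neg_tent, neg_mul]
  rw [e, SLam_const_mul, smul_smul]
  congr 1
  field_simp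

/-! ## §2 The record's Hessian table is entrywise bounded -/

omit [NeZero Lc] in
/-- [folklore] (LH) at rate `0`: `tabs.H` is entrywise bounded by ONE constant. -/
theorem exists_abs_tabsH_le [NeZero Lc] : ∃ CH : ℝ, ∀ μ y x z a b, |tabs.H μ y x z a b| ≤ CH := by
  obtain ⟨CH, hQ⟩ := tabs.hH 0 le_rfl
  refine ⟨CH, fun μ y x z a b => ?_⟩
  have h := hQ μ y x z a b
  simp only [neg_zero, zero_mul, Real.exp_zero, mul_one] at h
  exact h

/-! ## §3 The contour-summed averaging lift of the comb Λ-source is the Λ-increment of the lifted table -/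

include hHff in
/-- NOT IN PRINT; OUR BOOKKEEPING ([folklore]; the (III′) twin of the OWNER's `BornLambdaLift.borderSum_unitS_freshAt_lam_succ`).  **THE CONTOUR-SUMMED AVERAGING LIFT OF THE
COMB Λ-SOURCE OF MEMBER `j+1` IS THE Λ-INCREMENT OF THE LIFTED TABLE WITH THE WEIGHT `cΛ·(Lc^(j+1))^{2(d+1)}`**:
`borderSum (Lc^(j+1)) (unitS_{j+1} (combFreshAt tabs 0 cΛ (j+1))) κ u = (cΛ·(Lc^(j+1))^{2(d+1)}) • SLam (Lc^(j+2)) (lamCoeffOf (KInv (Lc^(j+2))) (Lc^(j+2))) (avgLift (Lc^(j+1)) ∘ tabs.H) κ u`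
(§1, the OWNER's `borderSum_SLam` with §2's bound, `𝒬ᵀ_{Lc^(j+1)}𝒬ᵀ_{Lc} = 𝒬ᵀ_{Lc^(j+2)}` and `𝒬ᵀ_{Lc^(j+2)}[wΦ_{Lc^(j+2)}] = −lamCoeffOf (KInv _) _` BY NAME — the (E) proof token for token). -/
theorem borderSum_unitS_combFreshAt_lam_succ (cΛ : ℝ) (j : ℕ) (κ : Fin (d + 1)) (u : Fin (d + 1) → ℤ) :
    borderSum (Lc ^ (j + 1)) (unitS (sfStep Lc (j + 1)) (smStep d Lc (j + 1)) (combFreshAt tabs 0 cΛ (j + 1))) κ u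
      = (cΛ * ((Lc : ℝ) ^ (j + 1)) ^ (2 * (d + 1))) •
          SLam (Lc ^ (j + 1 + 1)) (lamCoeffOf (KInv (N := Lc ^ (j + 1 + 1)) (d := d)) (Lc ^ (j + 1 + 1))) (fun μ y => avgLift (Lc ^ (j + 1)) (tabs.H μ y)) κ u := by
  set E : ℝ := ((Lc : ℝ) ^ (j + 1)) ^ (2 * (d + 1)) with hE
  -- the source as ONE Λ-piece with the weight inside the coefficient
  have e0 : unitS (sfStep Lc (j + 1)) (smStep d Lc (j + 1)) (combFreshAt tabs 0 cΛ (j + 1))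
      = SLam Lc (fun μ y κ' u' => (-cΛ) *
          contourSumAdj Lc (fun κ'' y'' => E * wΦ (N := Lc ^ (j + 2)) (d := d) κ'' μ (y'' - y)) κ' u') tabs.H := by
    rw [unitS_combFreshAt_lam_succ_eq_tent tabs hHff]
    funext κ' u'
    rw [SLam_const_mul]
  -- decay of the coefficient, boundedness of the tables
  obtain ⟨C, δ, hδ, hc⟩ := abs_tentCoeff_le (d := d) (Lc := Lc) (Lc ^ (j + 2)) E
  obtain ⟨CH, hH⟩ := exists_abs_tabsH_le tabs
  have hc' : ∀ (μ : Fin (d + 1)) (y : Fin (d + 1) → ℤ) (κ' : Fin (d + 1)) (u' : Fin (d + 1) → ℤ),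
      |(-cΛ) * contourSumAdj Lc (fun κ'' y'' => E * wΦ (N := Lc ^ (j + 2)) (d := d) κ'' μ (y'' - y)) κ' u'|
        ≤ |cΛ| * C * Real.exp (-δ * l1 ((Lc : ℤ) • y - u')) := by
    intro μ y κ' u'
    rw [abs_mul, abs_neg, mul_assoc]
    exact mul_le_mul_of_nonneg_left (hc μ y κ' u') (abs_nonneg _)
  rw [e0, borderSum_SLam (M := Lc ^ (j + 1)) (L := Lc) (Lc ^ (j + 1 + 1)) hc' hδ hH]
  -- the lifted coefficient is `(cΛ·E) · lamCoeffOf (KInv (Lc^(j+2))) (Lc^(j+2))`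
  have e1 : (fun μ y κ' u' => contourSumAdj (Lc ^ (j + 1)) (fun κ₁ u₁ => (-cΛ) *
        contourSumAdj Lc (fun κ'' y'' => E * wΦ (N := Lc ^ (j + 2)) (d := d) κ'' μ (y'' - y)) κ₁ u₁) κ' u')
      = fun μ y κ' u' => (cΛ * E) * lamCoeffOf (KInv (N := Lc ^ (j + 1 + 1)) (d := d)) (Lc ^ (j + 1 + 1)) μ y κ' u' := by
    funext μ y κ' u'
    rw [contourSumAdj_const_mul, ← congrFun (congrFun (contourSumAdj_mul (Lc ^ (j + 1)) Lc _) κ') u', ← pow_succ,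
      contourSumAdj_const_mul, lamCoeffOf_KInv_eq_neg_contourSumAdj_shift]
    ring
  rw [e1, SLam_const_mul]

/-! ## §4 The undressed Λ-lineages of the comb-chart remainder as one-shot third jets of Λ-pieces of the lifted table -/

include hHff in
/-- NOT IN PRINT; OUR BOOKKEEPING ([folklore]; the (III′) twin of the OWNER's `BornLambdaLift.lineage_succ_eq_e3OfS_lagrIncAt`, generic table).  **THE UNDRESSED Λ-LINEAGE
BORN AT LEVEL `j+1` AND READ AT LEVEL `j+n+2` IS THE ONE-SHOT THIRD JET OF THE Λ-INCREMENT OF THE LIFTED TABLE**: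
`push₃ B B B (unitS_{j+1} (combFreshAt tabs 0 cΛ (j+1))) κ′ u′ = e3OfS (Lc^(j+n+2)) ((((Lc^(j+1))^{d+2})²·cΛ·(Lc^(j+1))^{2(d+1)}) • SLam (Lc^(j+2)) (lamCoeffOf …) (avgLift (Lc^(j+1)) ∘ tabs.H)) κ′ u′`,
`B = respStep (Lc^(j+1)) (Lc^(j+n+2))` (the OWNER's §2 `push₃_respStep_eq_e3OfS_borderSum` at `M = Lc^(j+1)`, `L = Lc^(n+1)` + §3). -/
theorem lineage_succ_eq_e3OfS (cΛ : ℝ) (j n : ℕ) (κ' : Fin (d + 1)) (u' : Fin (d + 1) → ℤ) :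
    push₃ (respStep (d := d) (Lc ^ (j + 1)) (Lc ^ (j + n + 1 + 1))) (respStep (d := d) (Lc ^ (j + 1)) (Lc ^ (j + n + 1 + 1)))
        (respStep (d := d) (Lc ^ (j + 1)) (Lc ^ (j + n + 1 + 1)))
        (unitS (sfStep Lc (j + 1)) (smStep d Lc (j + 1)) (combFreshAt tabs 0 cΛ (j + 1))) κ' u'
      = e3OfS (Lc ^ (j + n + 1 + 1)) (fun κ u => ((((Lc : ℝ) ^ (j + 1)) ^ (d + 2)) ^ 2 * (cΛ * ((Lc : ℝ) ^ (j + 1)) ^ (2 * (d + 1)))) •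
          SLam (Lc ^ (j + 1 + 1)) (lamCoeffOf (KInv (N := Lc ^ (j + 1 + 1)) (d := d)) (Lc ^ (j + 1 + 1))) (fun μ y => avgLift (Lc ^ (j + 1)) (tabs.H μ y)) κ u)
          κ' u' := by
  obtain ⟨Cs, δ, hδ, hS⟩ := isLoc_unitS_combFreshAt_lam tabs 0 cΛ (j + 1) (sfStep Lc (j + 1)) (smStep d Lc (j + 1))
  have hff : ∀ κ u, IsFF (unitS (sfStep Lc (j + 1)) (smStep d Lc (j + 1)) (combFreshAt tabs 0 cΛ (j + 1)) κ u) :=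
    fun κ u => isFF_unitS (isFF_combFreshAt_lam tabs hHff cΛ (j + 1)) _ _ κ u
  have hN : Lc ^ (j + n + 1 + 1) = Lc ^ (j + 1) * Lc ^ (n + 1) := by rw [← pow_add, show j + n + 1 + 1 = j + 1 + (n + 1) by omega]
  rw [push₃_respStep_eq_e3OfS_borderSum (M := Lc ^ (j + 1)) (L := Lc ^ (n + 1)) hN hS hδ hff]
  have hF : (fun κ u => ((((Lc ^ (j + 1) : ℕ) : ℝ) ^ (d + 2)) ^ 2) •
        borderSum (Lc ^ (j + 1)) (unitS (sfStep Lc (j + 1)) (smStep d Lc (j + 1)) (combFreshAt tabs 0 cΛ (j + 1))) κ u)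
      = fun κ u => ((((Lc : ℝ) ^ (j + 1)) ^ (d + 2)) ^ 2 * (cΛ * ((Lc : ℝ) ^ (j + 1)) ^ (2 * (d + 1)))) •
          SLam (Lc ^ (j + 1 + 1)) (lamCoeffOf (KInv (N := Lc ^ (j + 1 + 1)) (d := d)) (Lc ^ (j + 1 + 1))) (fun μ y => avgLift (Lc ^ (j + 1)) (tabs.H μ y)) κ u := by
    funext κ u
    rw [borderSum_unitS_combFreshAt_lam_succ tabs hHff cΛ j κ u, smul_smul, Nat.cast_pow]
  rw [hF]

include hHff in
/-- NOT IN PRINT; OUR BOOKKEEPING ([folklore]; the (III′) twin of `BornLambdaLift.lineage_zero_eq_e3OfS`).  **THE UNDRESSED Λ-LINEAGE BORN AT LEVEL `0` AND READ AT LEVEL `k` IS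
THE ONE-SHOT THIRD JET OF THE ONE-STEP Λ-PIECE OF `tabs.H`**: `push₃ B B B (unitS_0 (combFreshAt tabs 0 cΛ 0)) κ′ u′ = e3OfS (Lc^k) (cΛ • SLam Lc (lamCoeffOf (KInv Lc) Lc) tabs.H) κ′ u′`,
`B = respStep (Lc^0) (Lc^k)` (M.58 `unitS_combFreshAt_lam_zero` + the OWNER's g19 `WilsonSectorUndressedRow.e3OfS_eq_push₃`). -/
theorem lineage_zero_eq_e3OfS (cΛ : ℝ) (k : ℕ) (κ' : Fin (d + 1)) (u' : Fin (d + 1) → ℤ) :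
    push₃ (respStep (d := d) (Lc ^ 0) (Lc ^ k)) (respStep (d := d) (Lc ^ 0) (Lc ^ k)) (respStep (d := d) (Lc ^ 0) (Lc ^ k))
        (unitS (sfStep Lc 0) (smStep d Lc 0) (combFreshAt tabs 0 cΛ 0)) κ' u'
      = e3OfS (Lc ^ k) (fun κ u => cΛ • SLam Lc (lamCoeffOf (KInv (N := Lc) (d := d)) Lc) tabs.H κ u) κ' u' := by
  have hff : ∀ κ u, IsFF ((fun κ u => cΛ • SLam Lc (lamCoeffOf (KInv (N := Lc) (d := d)) Lc) tabs.H κ u) κ u) :=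
    fun κ u => isFF_smul (isFF_SLam_of_isFF hHff _ κ u) cΛ
  rw [pow_zero, unitS_combFreshAt_lam_zero, e3OfS_eq_push₃ hff]

/-! ## §5 At an1's symmetrised table: the lineages are road S3's sym row objects -/

include hHff in
/-- NOT IN PRINT; OUR BOOKKEEPING ([folklore]).  **AT THE SYM TABLE** (`tabs.H = symHessFFAt ρ Lc`): the undressed Λ-lineage born at `j+1`, read at `j+n+2`, is
`e3OfS (Lc^(j+n+2)) ((((Lc^(j+1))^{d+2})²·cΛ·(Lc^(j+1))^{2(d+1)}) • symLagrIncAt d ρ Lc (Lc^(j+1)) (Lc^(j+2)))` — road S3's row-Λ ∕ row-Λt object FOR THE SYM TABLE (M.69 ∕ M.72). -/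
theorem lineage_succ_eq_e3OfS_symLagrIncAt {ρ : Fin (d + 1) → ℤ} (hH : tabs.H = symHessFFAt ρ Lc) (cΛ : ℝ) (j n : ℕ) (κ' : Fin (d + 1)) (u' : Fin (d + 1) → ℤ) :
    push₃ (respStep (d := d) (Lc ^ (j + 1)) (Lc ^ (j + n + 1 + 1))) (respStep (d := d) (Lc ^ (j + 1)) (Lc ^ (j + n + 1 + 1)))
        (respStep (d := d) (Lc ^ (j + 1)) (Lc ^ (j + n + 1 + 1)))
        (unitS (sfStep Lc (j + 1)) (smStep d Lc (j + 1)) (combFreshAt tabs 0 cΛ (j + 1))) κ' u'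
      = e3OfS (Lc ^ (j + n + 1 + 1)) (fun κ u => ((((Lc : ℝ) ^ (j + 1)) ^ (d + 2)) ^ 2 * (cΛ * ((Lc : ℝ) ^ (j + 1)) ^ (2 * (d + 1)))) •
          symLagrIncAt d ρ Lc (Lc ^ (j + 1)) (Lc ^ (j + 1 + 1)) κ u) κ' u' := by
  rw [lineage_succ_eq_e3OfS tabs hHff cΛ j n κ' u']
  simp only [symLagrIncAt, hH]

include hHff in
/-- NOT IN PRINT; OUR BOOKKEEPING ([folklore]).  **AT THE SYM TABLE, MEMBER `0`**: the undressed Λ-lineage born at `0`, read at `k`, is `e3OfS (Lc^k) (cΛ • SLam Lc (lamCoeffOf (KInv Lc) Lc)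
(symHessFFAt ρ Lc))` — road S3's row-Λ0 object FOR THE SYM `S₀` STENCIL (M.74). -/
theorem lineage_zero_eq_e3OfS_sym {ρ : Fin (d + 1) → ℤ} (hH : tabs.H = symHessFFAt ρ Lc) (cΛ : ℝ) (k : ℕ) (κ' : Fin (d + 1)) (u' : Fin (d + 1) → ℤ) :
    push₃ (respStep (d := d) (Lc ^ 0) (Lc ^ k)) (respStep (d := d) (Lc ^ 0) (Lc ^ k)) (respStep (d := d) (Lc ^ 0) (Lc ^ k))
        (unitS (sfStep Lc 0) (smStep d Lc 0) (combFreshAt tabs 0 cΛ 0)) κ' u'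
      = e3OfS (Lc ^ k) (fun κ u => cΛ • SLam Lc (lamCoeffOf (KInv (N := Lc) (d := d)) Lc) (fun μ y => symHessFFAt ρ Lc μ y) κ u) κ' u' := by
  rw [lineage_zero_eq_e3OfS tabs hHff cΛ k κ' u', hH]

end Summit.QuantumFields.BalabanUV.Beta.GAN24.CombBornLambdaLift

end
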